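import Summits.CriticalPhenomena.PercolationContinuityZ3.Theorems.Transplant.FKThreeApexRimStep
import Summits.CriticalPhenomena.PercolationContinuityZ3.Theorems.Transplant.FKThreeApexOmegaClosure1
import Summits.CriticalPhenomena.PercolationContinuityZ3.Theorems.Transplant.FKThreeApexT3Envelope
import HarnessLib

/-!
# The upper-envelope condition `(U_a)` along the detach flow of a rim step: linear structure and strict inflow at the boundary

Helper file (`--supports stmt-CriticalPhenomena-4575`), FK sub-lane `prim-bschramm-fk-3` (gen 25); builds on p205010 (kernel theorem,
internal audit signed; external expert review pending).  Pure real algebra; no sorries; standard axioms.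
Memo `bschramm/prim-bschramm-fk-3/U-RIM.md`.  The topological conclusion (`(U_a)` survives rim steps, `U` on `InKE`) is the sequel
`…ThreeApexUCondRimStep`.

The square-root-free upper-envelope condition `(U_a)` of `…ThreeApexT5` / `…ThreeApexOmega` — `Φ_a(w₁,w₂)(Z) ≥ 0` for all `w₁,w₂ ≥ 0`,
equivalently `(√N^{(ab)} + √N^{(ac)})² ≥ M_a` — is the one inequality of the three-apex package whose survival under the rim step
`E_r = r·id + (1−r)·detach` of double fans (`…ThreeApexRimStep`) was open (memo `SAME-APEX-LEAN.md` §5, "U on InKE").  Contents: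
* **Linear structure** (`uForm_eq_wlin`): with `W := qZ_0 + Z_ab + Z_ac + qZ_bc + Z_1` and the Harris defect `J_a = Z_bc(Z_ab+Z_ac) − Z_0Z_1`:
  `Φ_a(w₁,w₂) = W·(w₁²Z_ab + w₂²Z_ac) + J_a·((1−q)(w₁+w₂)² + q w₁w₂)`, `N^{(ab)} = Z_abW + (1−q)J_a`, `N^{(ac)} = Z_acW + (1−q)J_a`,
  `M_a = (Z_ab+Z_ac)W − qJ_a`; hence (`uCond_iff_disc`) for masses `≥ 0`: `(U_a) ⟺ J_a ≥ 0 ∨ Δ_U ≥ 0` with the binary quadratic form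
  `Δ_U = 4Z_abZ_acW² + 4(1−q)(Z_ab+Z_ac)W J_a − q(4−3q)J_a² = 4N^{(ab)}N^{(ac)} − (2−q)²J_a² = 4M_aN^{(ac)} − (2Z_acW − qJ_a)²`
  (the tight probe ratio `ω₀ = (2Z_acW − qJ_a)/(2M_a)` of a boundary point depends on `q` and `Z_ab : Z_ac` only).
* **The flow** `flow q t Z = Z + t·detach Z` (`E_r Z = r·flow q ((1−r)/r) Z`, `rimStep_eq_scaleV_flow`): `J_a`, `W` move affinely and
  `Δ_U(flow_t Z) = Δ_U(Z) + t·g(t)` (`discU_flow`) with an explicit polynomial `g`, `g(0) = c₁(Z)` (`dc1`).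
* **Strict inflow** (`dc1_pos_of_boundary`): on the curved boundary `{Δ_U = 0, J_a < 0}` one has `c₁ > 0`, from three exact identities
  (`2M_a c₁ = 2a·K̂ + γΔ_U`, `K̂·P̂ = εF̂ − qa(qZ_ab+Z_1)Δ_U`, `W·P̂ = ρ̂ε(Z_ab+Z_ac+Z_1) − qΔ_U`) and `F̂ > 0` (two-case sign argument
  using `N^{(ac)} ≥ 0`); and `dc1_pos_of_jA_zero` on `{J_a = 0}`.  No `U_b`, `U_c`, `Λ`, `κ` hypotheses are needed anywhere.
[cite: Grimmett2006, §3.9 eq. (3.94) (pp. 63–64)] [folklore]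
-/

noncomputable section

namespace Summit.CriticalPhenomena.PercolationContinuityZ3.Theorems

namespace FK

namespace ThreeApex

/-! ### The condition `(U_a)` and its linear structure -/

/-- `(U_a)`: `Φ_a(w₁,w₂)(Z) ≥ 0` for all `w₁, w₂ ≥ 0`. [folklore] -/
def UCond (q : ℝ) (Z : V5) : Prop := ∀ w₁ w₂ : ℝ, 0 ≤ w₁ → 0 ≤ w₂ → 0 ≤ uForm q w₁ w₂ Z

/-- The positive linear form `W = qZ_0 + Z_ab + Z_ac + qZ_bc + Z_1`. [folklore] -/
def wlin (q : ℝ) (Z : V5) : ℝ := q * Z.z0 + Z.zab + Z.zac + q * Z.zbc + Z.z1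

/-- The Harris defect in fibre coordinates: `J_a = Z_bc(Z_ab + Z_ac) − Z_0 Z_1`. [folklore] -/
theorem jA_eq (Z : V5) : jA Z = Z.zbc * (Z.zab + Z.zac) - Z.z0 * Z.z1 := by
  simp only [jA, hx, hy, hz, V5.total]; ring

/-- `W ≥ 0` for masses `≥ 0`, `q ≥ 0`. [folklore] -/
theorem wlin_nonneg {q : ℝ} (hq : 0 ≤ q) {Z : V5} (hZ : Z.Nonneg) : 0 ≤ wlin q Z := by
  obtain ⟨h0, h1, h2, h3, h4⟩ := hZ; simp only [wlin]; positivity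

/-- `N^{(ac)} = Z_ac·W + (1−q)·J_a`. [folklore] -/
theorem masterN_eq_wlin (q : ℝ) (Z : V5) : masterN q Z = Z.zac * wlin q Z + (1 - q) * jA Z := by
  simp only [masterN, wlin, jA_eq]; ring

/-- `N^{(ab)} = Z_ab·W + (1−q)·J_a`. [folklore] -/
theorem masterNab_eq_wlin (q : ℝ) (Z : V5) : masterN q (swapBC Z) = Z.zab * wlin q Z + (1 - q) * jA Z := by
  simp only [masterN, swapBC, wlin, jA_eq]; ring

/-- `M_a = (Z_ab + Z_ac)·W − q·J_a`. [folklore] -/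
theorem massA_eq_wlin (q : ℝ) (Z : V5) : massA q Z = (Z.zab + Z.zac) * wlin q Z - q * jA Z := by
  simp only [massA, wlin, jA_eq]; ring

/-- **Linear structure of `Φ_a`**: `Φ_a(w₁,w₂) = W(w₁²Z_ab + w₂²Z_ac) + J_a((1−q)(w₁+w₂)² + q w₁w₂)`. [folklore] -/
theorem uForm_eq_wlin (q w₁ w₂ : ℝ) (Z : V5) :
    uForm q w₁ w₂ Z = wlin q Z * (w₁ ^ 2 * Z.zab + w₂ ^ 2 * Z.zac) + jA Z * ((1 - q) * (w₁ + w₂) ^ 2 + q * w₁ * w₂) := by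
  simp only [uForm, masterN, massA, swapBC, wlin, jA_eq]; ring

/-- The discriminant form `Δ_U = 4Z_abZ_acW² + 4(1−q)(Z_ab+Z_ac)W J_a − q(4−3q)J_a²`. [folklore] -/
def discU (q : ℝ) (Z : V5) : ℝ :=
  4 * Z.zab * Z.zac * wlin q Z ^ 2 + 4 * (1 - q) * (Z.zab + Z.zac) * wlin q Z * jA Z - q * (4 - 3 * q) * jA Z ^ 2

/-- `Δ_U = 4 N^{(ab)} N^{(ac)} − ((2−q)J_a)²`. [folklore] -/
theorem discU_eq_masterN (q : ℝ) (Z : V5) :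
    discU q Z = 4 * masterN q (swapBC Z) * masterN q Z - ((2 - q) * jA Z) ^ 2 := by
  rw [masterNab_eq_wlin, masterN_eq_wlin]; simp only [discU]; ring

/-- `Δ_U = 4 M_a N^{(ac)} − (2Z_acW − qJ_a)²`. [folklore] -/
theorem discU_eq_massA (q : ℝ) (Z : V5) :
    discU q Z = 4 * massA q Z * masterN q Z - (2 * Z.zac * wlin q Z - q * jA Z) ^ 2 := by
  rw [masterN_eq_wlin, massA_eq_wlin]; simp only [discU]; ring

/-- The mirror identity `Δ_U = 4 M_a N^{(ab)} − (2Z_abW − qJ_a)²`. [folklore] -/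
theorem discU_eq_massA' (q : ℝ) (Z : V5) :
    discU q Z = 4 * massA q Z * masterN q (swapBC Z) - (2 * Z.zab * wlin q Z - q * jA Z) ^ 2 := by
  rw [masterNab_eq_wlin, massA_eq_wlin]; simp only [discU]; ring

/-- `(U_a)` from `J_a ≥ 0 ∨ Δ_U ≥ 0` (masses `≥ 0`, `0 < q ≤ 1`). [folklore] -/
theorem uCond_of_disc {q : ℝ} (hq0 : 0 < q) (hq1 : q ≤ 1) {Z : V5} (hZ : Z.Nonneg) (h : 0 ≤ jA Z ∨ 0 ≤ discU q Z) :
    UCond q Z := by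
  intro w₁ w₂ hw₁ hw₂
  have hW : 0 ≤ wlin q Z := wlin_nonneg hq0.le hZ
  obtain ⟨h0, h1, h2, h3, h4⟩ := hZ
  have hq' : 0 ≤ 1 - q := sub_nonneg.2 hq1
  by_cases hJ : 0 ≤ jA Z
  · rw [uForm_eq_wlin]; positivity
  · have hJ' : jA Z < 0 := lt_of_not_ge hJ
    have hD : 0 ≤ discU q Z := h.resolve_left hJ
    have hM : 0 < massA q Z := by rw [massA_eq_wlin]; nlinarith
    have hNac : 0 ≤ masterN q Z := by
      have e := discU_eq_massA q Z
      nlinarith [sq_nonneg (2 * Z.zac * wlin q Z - q * jA Z)]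
    have hNab : 0 ≤ masterN q (swapBC Z) := by
      have e := discU_eq_massA' q Z
      nlinarith [sq_nonneg (2 * Z.zab * wlin q Z - q * jA Z)]
    rw [uForm_eq]
    refine H5.quad_nonneg hNab hNac ?_ w₁ w₂
    have e := discU_eq_masterN q Z
    linarith

/-- `J_a ≥ 0 ∨ Δ_U ≥ 0` from `(U_a)` (`q ≤ 1`). [folklore] -/
theorem UCond.disc {q : ℝ} (hq1 : q ≤ 1) {Z : V5} (h : UCond q Z) : 0 ≤ jA Z ∨ 0 ≤ discU q Z := by
  have H := H5.quad_copos_iff_aux (α := masterN q (swapBC Z)) (β := masterN q Z) (γ := (2 - q) * jA Z)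
    (fun w₁ w₂ hw₁ hw₂ => by rw [← uForm_eq]; exact h w₁ w₂ hw₁ hw₂)
  rcases H.2.2 with h1 | h1
  · left
    have hp : 0 < 2 - q := by linarith
    by_contra hc
    exact absurd h1 (not_le.2 (mul_neg_of_pos_of_neg hp (lt_of_not_ge hc)))
  · right; rw [discU_eq_masterN]; linarith

/-- For masses `≥ 0` and `0 < q ≤ 1`: `(U_a) ⟺ J_a ≥ 0 ∨ Δ_U ≥ 0`. [folklore] -/
theorem uCond_iff_disc {q : ℝ} (hq0 : 0 < q) (hq1 : q ≤ 1) {Z : V5} (hZ : Z.Nonneg) :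
    UCond q Z ↔ (0 ≤ jA Z ∨ 0 ≤ discU q Z) :=
  ⟨fun h => h.disc hq1, uCond_of_disc hq0 hq1 hZ⟩

/-! ### The detach flow -/

/-- The ray of the rim step: `flow q t Z = Z + t·detach Z` (`t ≥ 0`); `E_r Z = r·flow q ((1−r)/r) Z`. [folklore] -/
def flow (q t : ℝ) (Z : V5) : V5 :=
  ⟨Z.z0 + t * (q * Z.z0 + Z.zac + Z.zbc), Z.zab + t * (q * Z.zab + Z.z1), Z.zac, Z.zbc, Z.z1⟩

/-- `flow q 0 = id`. [folklore] -/
theorem flow_zero (q : ℝ) (Z : V5) : flow q 0 Z = Z := by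
  ext <;> simp [flow]

/-- Semigroup law of the ray (`detach ∘ detach = q·detach`): `flow_τ (flow_x Z) = flow_{x + τ(1+qx)} Z`. [folklore] -/
theorem flow_flow (q x τ : ℝ) (Z : V5) : flow q τ (flow q x Z) = flow q (x + τ * (1 + q * x)) Z := by
  ext <;> simp only [flow] <;> ring

/-- The flow preserves non-negative masses (`q, t ≥ 0`). [folklore] -/
theorem flow_nonneg {q t : ℝ} (hq : 0 ≤ q) (ht : 0 ≤ t) {Z : V5} (hZ : Z.Nonneg) : (flow q t Z).Nonneg := by
  obtain ⟨h0, h1, h2, h3, h4⟩ := hZ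
  refine ⟨?_, ?_, ?_, ?_, ?_⟩ <;> simp only [flow] <;> positivity

/-- `Φ_a` is homogeneous of degree two (`scaleV` of `…ThreeApexT3Envelope`). [folklore] -/
theorem uForm_scaleV (q w₁ w₂ c : ℝ) (Z : V5) : uForm q w₁ w₂ (scaleV c Z) = c ^ 2 * uForm q w₁ w₂ Z := by
  simp only [uForm, masterN, massA, swapBC, scaleV]; ring

/-- For `r ≠ 0`: `E_r Z = r · flow q ((1−r)/r) Z`. [folklore] -/
theorem rimStep_eq_scaleV_flow (q : ℝ) {r : ℝ} (hr : r ≠ 0) (Z : V5) :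
    rimStep q r Z = scaleV r (flow q ((1 - r) / r) Z) := by
  ext <;> simp only [rimStep, scaleV, flow]
  · field_simp
  · field_simp

/-- `J_a` along the flow: `J_a(flow_t Z) = (1+qt)J_a(Z) − t·Z_ac·(qZ_bc + Z_1)`. [folklore] -/
theorem jA_flow (q t : ℝ) (Z : V5) : jA (flow q t Z) = (1 + q * t) * jA Z - t * (Z.zac * (q * Z.zbc + Z.z1)) := by
  simp only [jA_eq, flow]; ring

/-- Velocity of `W`: `qW + (1−q)(qZ_bc + Z_1)`. [folklore] -/
def dW (q : ℝ) (Z : V5) : ℝ := q * wlin q Z + (1 - q) * (q * Z.zbc + Z.z1)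

/-- Velocity of `J_a`: `qJ_a − Z_ac(qZ_bc + Z_1)`. [folklore] -/
def dJ (q : ℝ) (Z : V5) : ℝ := q * jA Z - Z.zac * (q * Z.zbc + Z.z1)

/-- Velocity of `Z_ab`: `qZ_ab + Z_1`. [folklore] -/
def dX (q : ℝ) (Z : V5) : ℝ := q * Z.zab + Z.z1

/-- The difference quotient `g(t) = (Δ_U(flow_t Z) − Δ_U(Z))/t`, a polynomial in `t`. [folklore] -/
def gflow (q : ℝ) (Z : V5) (t : ℝ) : ℝ :=
  4 * Z.zac * (dX q Z * (wlin q Z + t * dW q Z) ^ 2 + Z.zab * (2 * wlin q Z * dW q Z + t * dW q Z ^ 2))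
    + 4 * (1 - q) * (dX q Z * (wlin q Z + t * dW q Z) * (jA Z + t * dJ q Z)
        + (Z.zab + Z.zac) * (dW q Z * jA Z + wlin q Z * dJ q Z + t * (dW q Z * dJ q Z)))
    - q * (4 - 3 * q) * (2 * jA Z * dJ q Z + t * dJ q Z ^ 2)

/-- The first Taylor coefficient `c₁(Z) = g(0) = d/dt Δ_U(flow_t Z)|_{t=0}`. [folklore] -/
def dc1 (q : ℝ) (Z : V5) : ℝ :=
  4 * Z.zac * (dX q Z * wlin q Z ^ 2 + 2 * Z.zab * wlin q Z * dW q Z)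
    + 4 * (1 - q) * (dX q Z * wlin q Z * jA Z + (Z.zab + Z.zac) * (dW q Z * jA Z + wlin q Z * dJ q Z))
    - 2 * q * (4 - 3 * q) * jA Z * dJ q Z

/-- `g(0) = c₁`. [folklore] -/
theorem gflow_zero (q : ℝ) (Z : V5) : gflow q Z 0 = dc1 q Z := by
  simp only [gflow, dc1]; ring

/-- **`Δ_U` along the flow**: `Δ_U(flow_t Z) = Δ_U(Z) + t·g(t)`. [folklore] -/
theorem discU_flow (q t : ℝ) (Z : V5) : discU q (flow q t Z) = discU q Z + t * gflow q Z t := by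
  simp only [discU, gflow, dW, dJ, dX, wlin, jA_eq, flow]; ring

/-- `g` is continuous in `t`. [folklore] -/
theorem continuous_gflow (q : ℝ) (Z : V5) : Continuous (gflow q Z) := by
  unfold gflow; fun_prop

/-! ### The boundary package: `a`, `b`, `ρ̂`, `P̂`, `Ê`, `K̂`, `F̂`, `γ` -/

/-- `a = 2Z_acW − qJ_a` (`= 2M_a·ω₀`). [folklore] -/
def bdA (q : ℝ) (Z : V5) : ℝ := 2 * Z.zac * wlin q Z - q * jA Z

/-- `b = 2Z_abW − qJ_a` (`= 2M_a·(1−ω₀)`). [folklore] -/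
def bdB (q : ℝ) (Z : V5) : ℝ := 2 * Z.zab * wlin q Z - q * jA Z

/-- `ρ̂ = qa + (2−2q)·2M_a` (`= 2M_a·(qω₀ + 2 − 2q)`). [folklore] -/
def bdRho (q : ℝ) (Z : V5) : ℝ := q * bdA q Z + (2 - 2 * q) * (2 * massA q Z)

/-- `P̂ = ρ̂Z_1 − 2qbZ_ac`. [folklore] -/
def bdP (q : ℝ) (Z : V5) : ℝ := bdRho q Z * Z.z1 - 2 * q * bdB q Z * Z.zac

/-- `Ê = (1−q)aZ_ab − (2−q)·2M_a·Z_ac + aZ_ac`. [folklore] -/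
def bdE (q : ℝ) (Z : V5) : ℝ := (1 - q) * bdA q Z * Z.zab - (2 - q) * (2 * massA q Z) * Z.zac + bdA q Z * Z.zac

/-- `K̂ = a(qZ_ab+Z_1)W + (1−q)aZ_abε − ((2−q)·2M_a − a)Z_acε`, `ε = qZ_bc + Z_1`. [folklore] -/
def bdK (q : ℝ) (Z : V5) : ℝ :=
  bdA q Z * (q * Z.zab + Z.z1) * wlin q Z + (1 - q) * bdA q Z * Z.zab * (q * Z.zbc + Z.z1)
    - ((2 - q) * (2 * massA q Z) - bdA q Z) * Z.zac * (q * Z.zbc + Z.z1)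

/-- `F̂ = aρ̂(qZ_ab+Z_1)(Z_ab+Z_ac+Z_1) + Ê·P̂`. [folklore] -/
def bdF (q : ℝ) (Z : V5) : ℝ := bdA q Z * bdRho q Z * (q * Z.zab + Z.z1) * (Z.zab + Z.zac + Z.z1) + bdE q Z * bdP q Z

/-- The quadratic form `γ` of identity (I1). [folklore] -/
def bdGamma (q : ℝ) (Z : V5) : ℝ :=
  4 * q ^ 2 * Z.z0 * Z.z1 + 4 * q ^ 2 * Z.z0 * Z.zac + 6 * q ^ 2 * Z.z0 * Z.zab + 2 * q * Z.zbc * Z.z1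
    + 4 * q * Z.zac * Z.z1 + 2 * q * Z.zac * Z.zbc + 4 * q * Z.zac ^ 2 + 4 * q * Z.zab * Z.z1 + 2 * q * Z.zab * Z.zbc
    + 10 * q * Z.zab * Z.zac + 6 * q * Z.zab ^ 2 + 2 * q * Z.z0 * Z.z1 + 2 * Z.z1 ^ 2 + 4 * Z.zac * Z.z1 + 4 * Z.zab * Z.z1

/-- **(I1)** `2M_a·c₁ = 2a·K̂ + γ·Δ_U`. [folklore] -/
theorem bd_identity1 (q : ℝ) (Z : V5) : 2 * massA q Z * dc1 q Z = 2 * bdA q Z * bdK q Z + bdGamma q Z * discU q Z := by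
  simp only [dc1, dX, dW, dJ, bdA, bdK, bdGamma, discU, massA, wlin, jA_eq]; ring

/-- **(I2)** `K̂·P̂ = ε·F̂ − qa(qZ_ab+Z_1)·Δ_U`. [folklore] -/
theorem bd_identity2 (q : ℝ) (Z : V5) :
    bdK q Z * bdP q Z = (q * Z.zbc + Z.z1) * bdF q Z - q * bdA q Z * (q * Z.zab + Z.z1) * discU q Z := by
  simp only [bdK, bdP, bdF, bdE, bdRho, bdA, bdB, discU, massA, wlin, jA_eq]; ring

/-- **(I3)** `W·P̂ = ρ̂ε(Z_ab+Z_ac+Z_1) − qΔ_U`. [folklore] -/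
theorem bd_identity3 (q : ℝ) (Z : V5) :
    wlin q Z * bdP q Z = bdRho q Z * (q * Z.zbc + Z.z1) * (Z.zab + Z.zac + Z.z1) - q * discU q Z := by
  simp only [bdP, bdRho, bdA, bdB, discU, massA, wlin, jA_eq]; ring

/-- Expansion of `F̂` exhibiting its sign when `Ê < 0`. [folklore] -/
theorem bdF_expand (q : ℝ) (Z : V5) :
    bdF q Z = bdA q Z * bdRho q Z * q * Z.zab * (Z.zab + Z.zac) + bdA q Z * bdRho q Z * Z.z1 ^ 2
      + bdRho q Z * Z.z1 * (2 * q * (Z.zab * (Z.zac * wlin q Z - jA Z) + Z.zac * (Z.zac * wlin q Z + (1 - q) * jA Z)))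
      + (-bdE q Z) * (2 * q * bdB q Z * Z.zac) := by
  simp only [bdF, bdP, bdE, bdRho, bdA, bdB, massA, wlin, jA_eq]; ring

/-- `Δ_U = 4M_a(Z_acW + (1−q)J_a) − a²`. [folklore] -/
theorem discU_eq_bdA (q : ℝ) (Z : V5) : discU q Z = 4 * massA q Z * (Z.zac * wlin q Z + (1 - q) * jA Z) - bdA q Z ^ 2 := by
  rw [discU_eq_massA, masterN_eq_wlin]; rfl

/-! ### Strict inflow at the boundary -/

/-- **Strict inflow at the curved boundary**: `Δ_U(Z) = 0`, `J_a(Z) < 0` (masses `≥ 0`, `0 < q ≤ 1`) imply `c₁(Z) > 0`. [folklore] -/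
theorem dc1_pos_of_boundary {q : ℝ} (hq0 : 0 < q) (hq1 : q ≤ 1) {Z : V5} (hZ : Z.Nonneg) (hJ : jA Z < 0)
    (hD : discU q Z = 0) : 0 < dc1 q Z := by
  have hW0 : 0 ≤ wlin q Z := wlin_nonneg hq0.le hZ
  obtain ⟨h0, h1, h2, h3, h4⟩ := hZ
  have hq' : 0 ≤ 1 - q := sub_nonneg.2 hq1
  have hJe : jA Z = Z.zbc * (Z.zab + Z.zac) - Z.z0 * Z.z1 := jA_eq Z
  -- `Z_1 > 0`, `W > 0`, `ε > 0`
  have hC : 0 < Z.z1 := by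
    rcases h4.lt_or_eq with h | h
    · exact h
    · exfalso; rw [← h] at hJe; nlinarith
  have hW : 0 < wlin q Z := by simp only [wlin]; positivity
  have hε : 0 < q * Z.zbc + Z.z1 := by positivity
  -- `Z_ab, Z_ac > 0` (otherwise `Δ_U < 0`)
  have hJ2 : 0 < jA Z ^ 2 := by rw [pow_two]; exact mul_pos_of_neg_of_neg hJ hJ
  have h43 : 0 < q * (4 - 3 * q) := by nlinarith
  have hX : 0 < Z.zab := by
    rcases h1.lt_or_eq with h | h
    · exact h
    · exfalso
      have hneg : discU q Z < 0 := by
        have e : discU q Z = 4 * (1 - q) * Z.zac * wlin q Z * jA Z - q * (4 - 3 * q) * jA Z ^ 2 := by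
          simp only [discU, ← h]; ring
        rw [e]; nlinarith [mul_nonneg (mul_nonneg hq' h2) hW.le, mul_pos h43 hJ2]
      linarith
  have hY : 0 < Z.zac := by
    rcases h2.lt_or_eq with h | h
    · exact h
    · exfalso
      have hneg : discU q Z < 0 := by
        have e : discU q Z = 4 * (1 - q) * Z.zab * wlin q Z * jA Z - q * (4 - 3 * q) * jA Z ^ 2 := by
          simp only [discU, ← h]; ring
        rw [e]; nlinarith [mul_nonneg (mul_nonneg hq' h1) hW.le, mul_pos h43 hJ2]
      linarith
  -- `M_a, a, b, ρ̂ > 0`, `N^{(ac)} ≥ 0`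
  have hM : 0 < massA q Z := by rw [massA_eq_wlin]; nlinarith
  have ha : 0 < bdA q Z := by simp only [bdA]; nlinarith
  have hb : 0 < bdB q Z := by simp only [bdB]; nlinarith
  have hNac : 0 ≤ Z.zac * wlin q Z + (1 - q) * jA Z := by
    have e := discU_eq_bdA q Z
    nlinarith [sq_nonneg (bdA q Z)]
  have hρ : 0 < bdRho q Z := by simp only [bdRho]; nlinarith
  -- (I3) ⟹ `P̂ > 0`
  have hP : 0 < bdP q Z := by
    have hWP : 0 < wlin q Z * bdP q Z := by
      rw [bd_identity3, hD, mul_zero, sub_zero]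
      have : 0 < Z.zab + Z.zac + Z.z1 := by linarith
      positivity
    exact pos_of_mul_pos_right hWP hW.le
  -- `F̂ > 0`
  have hF : 0 < bdF q Z := by
    by_cases hE : 0 ≤ bdE q Z
    · have h1' : 0 < bdA q Z * bdRho q Z * (q * Z.zab + Z.z1) * (Z.zab + Z.zac + Z.z1) := by
        have : 0 < q * Z.zab + Z.z1 := by positivity
        have : 0 < Z.zab + Z.zac + Z.z1 := by linarith
        positivity
      have h2' : 0 ≤ bdE q Z * bdP q Z := mul_nonneg hE hP.le
      simp only [bdF]; linarith
    · have hE' : 0 ≤ -bdE q Z := by linarith [lt_of_not_ge hE]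
      have hYWJ : 0 ≤ Z.zac * wlin q Z - jA Z := by nlinarith
      have t1 : 0 ≤ bdA q Z * bdRho q Z * q * Z.zab * (Z.zab + Z.zac) := by positivity
      have t2 : 0 < bdA q Z * bdRho q Z * Z.z1 ^ 2 := by positivity
      have t3 : 0 ≤ bdRho q Z * Z.z1 *
          (2 * q * (Z.zab * (Z.zac * wlin q Z - jA Z) + Z.zac * (Z.zac * wlin q Z + (1 - q) * jA Z))) := by
        have : 0 ≤ Z.zab * (Z.zac * wlin q Z - jA Z) + Z.zac * (Z.zac * wlin q Z + (1 - q) * jA Z) := by positivity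
        positivity
      have t4 : 0 ≤ (-bdE q Z) * (2 * q * bdB q Z * Z.zac) := by positivity
      rw [bdF_expand]; linarith
  -- (I2) ⟹ `K̂ > 0`
  have hK : 0 < bdK q Z := by
    have hKP : 0 < bdK q Z * bdP q Z := by rw [bd_identity2, hD, mul_zero, sub_zero]; positivity
    exact pos_of_mul_pos_left hKP hP.le
  -- (I1) ⟹ `c₁ > 0`
  have hprod : 0 < 2 * massA q Z * dc1 q Z := by
    rw [bd_identity1, hD, mul_zero, add_zero]; positivity
  exact pos_of_mul_pos_right hprod (by positivity)

/-- The cofactor of `J_a` in `c₁ − 4Z_acW(3qZ_abW + (2−q)Z_abε + ε(qZ_ac+Z_1))`. [folklore] -/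
def bdKappa (q : ℝ) (Z : V5) : ℝ :=
  -4 * q ^ 3 * Z.zac * Z.zbc - 2 * q ^ 3 * Z.zab * Z.zbc - 6 * q ^ 3 * Z.z0 * Z.z1 - 8 * q ^ 3 * Z.z0 * Z.zac
    - 12 * q ^ 3 * Z.z0 * Z.zab - 4 * q ^ 2 * Z.zbc * Z.z1 - 10 * q ^ 2 * Z.zac * Z.z1 - 4 * q ^ 2 * Z.zac * Z.zbc
    - 8 * q ^ 2 * Z.zac ^ 2 - 8 * q ^ 2 * Z.zab * Z.z1 - 4 * q ^ 2 * Z.zab * Z.zbc - 20 * q ^ 2 * Z.zab * Z.zac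
    - 12 * q ^ 2 * Z.zab ^ 2 + 4 * q ^ 2 * Z.z0 * Z.z1 + 4 * q ^ 2 * Z.z0 * Z.zac + 12 * q ^ 2 * Z.z0 * Z.zab - 4 * q * Z.z1 ^ 2
    + 4 * q * Z.zbc * Z.z1 + 4 * q * Z.zac * Z.zbc + 4 * q * Z.zac ^ 2 + 4 * q * Z.zab * Z.zbc + 16 * q * Z.zab * Z.zac
    + 12 * q * Z.zab ^ 2 + 4 * q * Z.z0 * Z.z1 + 4 * Z.z1 ^ 2 + 8 * Z.zac * Z.z1 + 8 * Z.zab * Z.z1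

/-- `c₁` split along `J_a`. [folklore] -/
theorem dc1_eq_of_jA (q : ℝ) (Z : V5) :
    dc1 q Z = 4 * Z.zac * wlin q Z * (3 * q * Z.zab * wlin q Z + (2 - q) * Z.zab * (q * Z.zbc + Z.z1)
        + (q * Z.zbc + Z.z1) * (q * Z.zac + Z.z1)) + jA Z * bdKappa q Z := by
  simp only [dc1, dX, dW, dJ, bdKappa, wlin, jA_eq]; ring

/-- **Strict inflow at `J_a = 0`**: if `J_a(Z) = 0` and `Z_ac(qZ_bc + Z_1) ≠ 0` (masses `≥ 0`, `0 < q ≤ 1`), then `c₁(Z) > 0`. [folklore] -/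
theorem dc1_pos_of_jA_zero {q : ℝ} (hq0 : 0 < q) (hq1 : q ≤ 1) {Z : V5} (hZ : Z.Nonneg) (hJ : jA Z = 0)
    (hYe : Z.zac * (q * Z.zbc + Z.z1) ≠ 0) : 0 < dc1 q Z := by
  have hW0 : 0 ≤ wlin q Z := wlin_nonneg hq0.le hZ
  obtain ⟨h0, h1, h2, h3, h4⟩ := hZ
  have hq' : 0 ≤ 1 - q := sub_nonneg.2 hq1
  have h2q : 0 ≤ 2 - q := by linarith
  have hY : 0 < Z.zac := by
    rcases h2.lt_or_eq with h | h
    · exact h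
    · exfalso; exact hYe (by rw [← h, zero_mul])
  have hε : 0 < q * Z.zbc + Z.z1 := by
    have hε0 : 0 ≤ q * Z.zbc + Z.z1 := by positivity
    rcases hε0.lt_or_eq with h | h
    · exact h
    · exfalso; exact hYe (by rw [← h, mul_zero])
  have hW : 0 < wlin q Z := by simp only [wlin]; positivity
  rw [dc1_eq_of_jA, hJ, zero_mul, add_zero]
  have : 0 < 3 * q * Z.zab * wlin q Z + (2 - q) * Z.zab * (q * Z.zbc + Z.z1) + (q * Z.zbc + Z.z1) * (q * Z.zac + Z.z1) := by
    have : 0 < (q * Z.zbc + Z.z1) * (q * Z.zac + Z.z1) := by positivity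
    positivity
  positivity

end ThreeApex

end FK

end Summit.CriticalPhenomena.PercolationContinuityZ3.Theorems
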